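import Summits.QuantumFields.YangMills.Theorems.PoincareLipschitzLinAvgModCobdEll2
import Literature.MathematicalPhysics.QuantumFieldTheory.Balaban1983to89.T3ContinuumYM3Torus
import HarnessLib

/-!
# Line «poincare_lipschitz» on crux `HistoryTailL` (stmt-QuantumFields-19936), route crux `BlockLipschitzL` (stmt-QuantumFields-23533) — COMPLEMENT TO
# THE GAUSSIAN-MODEL SHADOW ✓`PoincareLipschitzLinAvgModCobdEll2` (LEAD w1 g7, p680819): LOCALITY (the shadow of `hStab`'s BOX norm), the TWO-FIELD form
# with ONE coboundary for all bonds, and the `T3Family` letters (rate `1/√(L^k)` at every depth)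

Cell `ym3-torus` (YM ladder rung R3 = continuum SU(2) Yang–Mills on the three-torus — a RUNG, NOT the Clay problem: not d = 4, not infinite volume, not a
mass gap); width seat `ym3-torus-px7` gen 4 on LEAD `ym-ust-19936-w1` g7's word «px7: SHADOW-LOCAL GO» (2026-08-29T00:19:25Z).  Helper
`--supports stmt-QuantumFields-23533`; LINEAR MODEL ONLY; imports the LEAD's file and REUSES its ✓`abs_tubeAvg_le_sqrt` (no restatement); nothing here
proves `hStab`, a stub, `BlockLipschitzL`, `HistoryTailL` or a summit statement.

CONTEXT.  ✓p680819 proves the shadow of the displayed row `hStab` in the Gaussian model with the GLOBAL `ℓ²` norm: for the `Φ` of the closed form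
✓`AbelianEML.linAvgIter_eq_tubeSum_sub_cobd`, `|linAvgIter k a c + cobd Φ c| ≤ √((L^k)²/(L^k)^d)·‖a‖_{ℓ²(torus)}`.  The row itself carries a BOX norm
(`Σ` over the level-0 bonds of the `17·L^{j+1}` box around `a`) and compares TWO fields through ONE gauge transformation `h` for all footprint bonds.
THIS FILE supplies exactly those two features in the linear model, plus the d = 3 letters:

* `tubeSum_eq_tubeSum_ite`, `abs_tubeAvg_le_sqrt_local` — the tube average at `c` reads `a` only on the tube bonds `(bsite k c₋ r + t e_κ, κ)`, so the
  sum of squares may be restricted to ANY bond set `S` containing that tube (the linear shadow of the box norm; the tube of a footprint bond lies in the box).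
* ★ `abs_linAvgIter_add_cobd_le_sqrt_local` — `|linAvgIter k a c + cobd Φ c| ≤ √((L^k)²/(L^k)^d)·(Σ_{b ∈ S} a_b²)^{1/2}` for the closed-form `Φ`
  (`abs_linAvgIter_add_cobd_le_sqrt` is the explicit-`Φ` global form, a two-line reading of ✓`abs_tubeAvg_le_sqrt`, kept as the building block).
* ★★ `exists_cobd_abs_linAvgIter_sub_le_sqrt` — TWO-FIELD FORM = `hStab` linearised: for all `a, a'` ONE site function `λ` on `T^{(k)}` with
  `|linAvgIter k a c − (linAvgIter k a' c + cobd λ c)| ≤ √((L^k)²/(L^k)^d)·‖a − a'‖_{ℓ²(S)}` for EVERY level-`k` bond `c` and every `S ⊇ tube(c)`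
  (`λ := −Φ_{a−a'}`, additivity ✓`AbelianEML.linAvgIter_add`) — `U ↦ a`, `U' ↦ a'`, `(Ū^k U')^h ↦ linAvgIter k a' + cobd λ`, `dist1(X·Y⁻¹) ↦ |X − Y|`.
* §3 `T3Family` letters: `sqrt_rate_T3 : √((L^k)²/(L^k)^3) = 1/√(L^k)`; ★★ `exists_cobd_abs_linAvgIter_sub_le_T3`, ★ `abs_linAvgIter_add_cobd_le_T3`,
  `exists_cobd_abs_linAvgIter_add_cobd_le_T3` — rate `1/√(L^k)` = the row's `CS/√(L^{k+1})` with `CS := √L`, uniformly in `k ≤ m + K`.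
[folklore]
-/
set_option autoImplicit false

noncomputable section

namespace Summit.QuantumFields.YangMills.Theorems.PoincareLipschitzLinAvgModCobdLocal

open scoped BigOperators Classical
open Literature.MathematicalPhysics.QuantumFieldTheory.Balaban1983to89
open Literature.MathematicalPhysics.QuantumFieldTheory.Balaban1983to89.B10Eq47AxialChi (shiftN)
open Summit.QuantumFields.YangMills.Theorems.AbelianEML
  (linAvgIter linAvgIter_add cobd tubeSum bsite linAvgIter_eq_tubeSum_sub_cobd)
open Summit.QuantumFields.YangMills.Theorems.PoincareLipschitzLinAvgModCobdEll2 (abs_tubeAvg_le_sqrt)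

variable {P : Params}

/-! ## §1  Locality of the tube average (the Cauchy–Schwarz + multiplicity bound is ✓`abs_tubeAvg_le_sqrt`, p680819) -/

/-- **LOCALITY OF THE TUBE SUM.**  If the predicate `S` holds on every tube bond `(bsite k c₋ r + t e_κ, κ)` of the level-`k`
bond `c`, then `tubeSum k a c = tubeSum k (𝟙_S·a) c`. [folklore] -/
theorem tubeSum_eq_tubeSum_ite {k : ℕ} (a : PBond P 0 → ℝ) (c : PBond P k) (S : PBond P 0 → Prop)
    (hS : ∀ (r : Fin P.d → Fin (P.L ^ k)) (t : Fin (P.L ^ k)), S ⟨shiftN (bsite k c.src r) c.dir t, c.dir⟩) :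
    tubeSum k a c = tubeSum k (fun b => if S b then a b else 0) c := by
  unfold tubeSum
  refine Finset.sum_congr rfl fun r _ => Finset.sum_congr rfl fun t _ => ?_
  dsimp only
  rw [if_pos (hS r t)]

/-- **THE LOCAL TUBE AVERAGE BOUND.**  With the sum of squares restricted to any bond set `S` containing the tube of `c`:
`|(L^k)^{−d}·tubeSum k a c| ≤ √((L^k)²/(L^k)^d)·(Σ_{b ∈ S} a_b²)^{1/2}`. [folklore] -/
theorem abs_tubeAvg_le_sqrt_local {k : ℕ} (hk : k ≤ P.m + P.K) (a : PBond P 0 → ℝ) (c : PBond P k) (S : PBond P 0 → Prop)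
    (hS : ∀ (r : Fin P.d → Fin (P.L ^ k)) (t : Fin (P.L ^ k)), S ⟨shiftN (bsite k c.src r) c.dir t, c.dir⟩) :
    |(((P.L : ℝ) ^ k) ^ P.d)⁻¹ * tubeSum k a c| ≤
      Real.sqrt (((P.L : ℝ) ^ k) ^ 2 / ((P.L : ℝ) ^ k) ^ P.d) * Real.sqrt (∑ b : PBond P 0, if S b then a b ^ 2 else 0) := by
  rw [tubeSum_eq_tubeSum_ite a c S hS]
  have h := abs_tubeAvg_le_sqrt hk (fun b => if S b then a b else 0) c
  have hsq : (∑ b : PBond P 0, (if S b then a b else 0) ^ 2) = ∑ b : PBond P 0, if S b then a b ^ 2 else 0 := by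
    refine Finset.sum_congr rfl fun b _ => ?_
    split_ifs <;> simp
  rwa [hsq] at h

/-! ## §2  The `k`-fold (0.4) linear average modulo its coboundary -/

/-- **★ BOND VALUE OF THE ITERATE MODULO ITS COBOUNDARY (global `ℓ²` norm).**  For the site function `Φ` of the closed form
`linAvgIter k a = (L^k)^{−d}·tubeSum k a − cobd Φ` (✓`AbelianEML.linAvgIter_eq_tubeSum_sub_cobd`) and every level-`k` bond `c`:
`|linAvgIter k a c + cobd Φ c| ≤ √((L^k)²/(L^k)^d)·(Σ_b a_b²)^{1/2}` — constant `1` at every depth. [folklore] -/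
theorem abs_linAvgIter_add_cobd_le_sqrt {k : ℕ} (hk : k ≤ P.m + P.K) (a : PBond P 0 → ℝ) (Φ : Site P k → ℝ)
    (hΦ : ∀ c : PBond P k, linAvgIter k a c = (((P.L : ℝ) ^ k) ^ P.d)⁻¹ * tubeSum k a c - cobd Φ c) (c : PBond P k) :
    |linAvgIter k a c + cobd Φ c| ≤
      Real.sqrt (((P.L : ℝ) ^ k) ^ 2 / ((P.L : ℝ) ^ k) ^ P.d) * Real.sqrt (∑ b : PBond P 0, a b ^ 2) := by
  rw [hΦ c, sub_add_cancel]
  exact abs_tubeAvg_le_sqrt hk a c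

/-- **★ BOND VALUE OF THE ITERATE MODULO ITS COBOUNDARY (local `ℓ²` norm).**  Same `Φ`; the sum of squares may be restricted to
any bond set `S` containing the tube of `c` — the linear bond value modulo the coboundary reads `a` only there. [folklore] -/
theorem abs_linAvgIter_add_cobd_le_sqrt_local {k : ℕ} (hk : k ≤ P.m + P.K) (a : PBond P 0 → ℝ) (Φ : Site P k → ℝ)
    (hΦ : ∀ c : PBond P k, linAvgIter k a c = (((P.L : ℝ) ^ k) ^ P.d)⁻¹ * tubeSum k a c - cobd Φ c) (c : PBond P k)
    (S : PBond P 0 → Prop)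
    (hS : ∀ (r : Fin P.d → Fin (P.L ^ k)) (t : Fin (P.L ^ k)), S ⟨shiftN (bsite k c.src r) c.dir t, c.dir⟩) :
    |linAvgIter k a c + cobd Φ c| ≤
      Real.sqrt (((P.L : ℝ) ^ k) ^ 2 / ((P.L : ℝ) ^ k) ^ P.d) * Real.sqrt (∑ b : PBond P 0, if S b then a b ^ 2 else 0) := by
  rw [hΦ c, sub_add_cancel]
  exact abs_tubeAvg_le_sqrt_local hk a c S hS

/-- **★★ THE LINEARISED `hStab` (two-field form; global and local in one).**  For all finest one-forms `a, a'` and every depth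
`k ≤ m + K` there is ONE site function `λ` on `T^{(k)}` such that for every level-`k` bond `c`
`|linAvgIter k a c − (linAvgIter k a' c + cobd λ c)| ≤ √((L^k)²/(L^k)^d)·(Σ_b (a_b − a'_b)²)^{1/2}`, and the sum may be restricted to
any bond set containing the tube of `c`.  (`λ := −Φ_{a−a'}`; additivity ✓`AbelianEML.linAvgIter_add`.) [folklore] -/
theorem exists_cobd_abs_linAvgIter_sub_le_sqrt {k : ℕ} (hk : k ≤ P.m + P.K) (a a' : PBond P 0 → ℝ) :
    ∃ lam : Site P k → ℝ, ∀ c : PBond P k,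
      |linAvgIter k a c - (linAvgIter k a' c + cobd lam c)| ≤
          Real.sqrt (((P.L : ℝ) ^ k) ^ 2 / ((P.L : ℝ) ^ k) ^ P.d) * Real.sqrt (∑ b : PBond P 0, (a b - a' b) ^ 2) ∧
        ∀ S : PBond P 0 → Prop,
          (∀ (r : Fin P.d → Fin (P.L ^ k)) (t : Fin (P.L ^ k)), S ⟨shiftN (bsite k c.src r) c.dir t, c.dir⟩) →
            |linAvgIter k a c - (linAvgIter k a' c + cobd lam c)| ≤
              Real.sqrt (((P.L : ℝ) ^ k) ^ 2 / ((P.L : ℝ) ^ k) ^ P.d) *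
                Real.sqrt (∑ b : PBond P 0, if S b then (a b - a' b) ^ 2 else 0) := by
  obtain ⟨Φ, hΦ⟩ := linAvgIter_eq_tubeSum_sub_cobd hk (a - a')
  refine ⟨fun y => -Φ y, fun c => ?_⟩
  -- additivity: `linAvgIter k a = linAvgIter k (a − a') + linAvgIter k a'`
  have hsplit : linAvgIter k a c = linAvgIter k (a - a') c + linAvgIter k a' c := by
    have h := linAvgIter_add k (a - a') a'
    rw [sub_add_cancel] at h
    rw [h]; rfl
  have hre : linAvgIter k a c - (linAvgIter k a' c + cobd (fun y => -Φ y) c) = linAvgIter k (a - a') c + cobd Φ c := by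
    rw [hsplit]; simp only [cobd]; ring
  rw [hre]
  exact ⟨abs_linAvgIter_add_cobd_le_sqrt hk (a - a') Φ hΦ c,
    fun S hS => abs_linAvgIter_add_cobd_le_sqrt_local hk (a - a') Φ hΦ c S hS⟩

/-! ## §3  The `T3Family` letters (d = 3): rate `1/√(L^k)` at every depth -/

section T3

open Literature.MathematicalPhysics.QuantumFieldTheory.Balaban1983to89.T3ContinuumYM3Torus

/-- In d = 3 the rate `√((L^k)²/(L^k)^d)` is `1/√(L^k)` (`= L^{−k/2}`). [folklore] -/
theorem sqrt_rate_T3 (F : T3Family) (K k : ℕ) :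
    Real.sqrt ((((F.P K).L : ℝ) ^ k) ^ 2 / (((F.P K).L : ℝ) ^ k) ^ (F.P K).d) = 1 / Real.sqrt ((F.L : ℝ) ^ k) := by
  have hPL : ((F.P K).L : ℝ) = F.L := rfl
  rw [T3Family.P_d, hPL]
  have hL0 : (0 : ℝ) < (F.L : ℝ) ^ k := by
    have : (0 : ℝ) < F.L := by have := F.hL.2; exact_mod_cast (by omega : 0 < F.L)
    positivity
  have e : ((F.L : ℝ) ^ k) ^ 2 / ((F.L : ℝ) ^ k) ^ 3 = 1 / (F.L : ℝ) ^ k := by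
    field_simp
  rw [e, Real.sqrt_div zero_le_one, Real.sqrt_one]

/-- **★★ THE GAUSSIAN-MODEL SHADOW OF `hStab` ON THE `T³` FAMILY.**  For every member `F.P K`, every depth `k ≤ m + K` and all real
finest one-forms `a, a'` there is ONE level-`k` site function `λ` with, for every level-`k` bond `c`,
`|linAvgIter k a c − (linAvgIter k a' c + cobd λ c)| ≤ (1/√(L^k))·(Σ_b (a_b − a'_b)²)^{1/2}`, the sum over all finest bonds or over
any bond set containing the tube of `c` — the linearisation of the displayed row `hStab` of ✓`blockLipschitzL_of_avgStabilityModGauge`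
(`Ū^k ↦ linAvgIter k`, gauge copy `↦ + cobd λ`, `dist1 ↦ |·|`), rate `CS/√(L^{k+1})` with `CS := √L`, uniformly in `k`. [folklore] -/
theorem exists_cobd_abs_linAvgIter_sub_le_T3 (F : T3Family) (K : ℕ) {k : ℕ} (hk : k ≤ F.m + K)
    (a a' : PBond (F.P K) 0 → ℝ) :
    ∃ lam : Site (F.P K) k → ℝ, ∀ c : PBond (F.P K) k,
      |linAvgIter k a c - (linAvgIter k a' c + cobd lam c)| ≤
          1 / Real.sqrt ((F.L : ℝ) ^ k) * Real.sqrt (∑ b : PBond (F.P K) 0, (a b - a' b) ^ 2) ∧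
        ∀ S : PBond (F.P K) 0 → Prop,
          (∀ (r : Fin (F.P K).d → Fin ((F.P K).L ^ k)) (t : Fin ((F.P K).L ^ k)),
              S ⟨shiftN (bsite k c.src r) c.dir t, c.dir⟩) →
            |linAvgIter k a c - (linAvgIter k a' c + cobd lam c)| ≤
              1 / Real.sqrt ((F.L : ℝ) ^ k) * Real.sqrt (∑ b : PBond (F.P K) 0, if S b then (a b - a' b) ^ 2 else 0) := by
  have hk' : k ≤ (F.P K).m + (F.P K).K := hk
  obtain ⟨lam, h⟩ := exists_cobd_abs_linAvgIter_sub_le_sqrt hk' a a'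
  refine ⟨lam, fun c => ?_⟩
  obtain ⟨h1, h2⟩ := h c
  rw [sqrt_rate_T3 F K k] at h1 h2
  exact ⟨h1, h2⟩

/-- **★ ONE-FIELD FORM ON THE `T³` FAMILY** (the word's letter «bond value of the `k`-fold LINEAR iterate modulo its coboundary
`≤ L^{−k/2}·‖a‖_{ℓ²}` at every depth»): for the `Φ` of the closed form, `|linAvgIter k a c + cobd Φ c| ≤ (1/√(L^k))·(Σ_b a_b²)^{1/2}`.
[folklore] -/
theorem abs_linAvgIter_add_cobd_le_T3 (F : T3Family) (K : ℕ) {k : ℕ} (hk : k ≤ F.m + K) (a : PBond (F.P K) 0 → ℝ)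
    (Φ : Site (F.P K) k → ℝ)
    (hΦ : ∀ c : PBond (F.P K) k,
      linAvgIter k a c = ((((F.P K).L : ℝ) ^ k) ^ (F.P K).d)⁻¹ * tubeSum k a c - cobd Φ c)
    (c : PBond (F.P K) k) :
    |linAvgIter k a c + cobd Φ c| ≤ 1 / Real.sqrt ((F.L : ℝ) ^ k) * Real.sqrt (∑ b : PBond (F.P K) 0, a b ^ 2) := by
  have hk' : k ≤ (F.P K).m + (F.P K).K := hk
  have h := abs_linAvgIter_add_cobd_le_sqrt hk' a Φ hΦ c
  rwa [sqrt_rate_T3 F K k] at h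

/-- **★ EXISTENCE FORM ON THE `T³` FAMILY**: for every `a` and depth `k ≤ m + K` there is `Φ` on `T^{(k)}` with
`|linAvgIter k a c + cobd Φ c| ≤ (1/√(L^k))·‖a‖_{ℓ²}` for every level-`k` bond `c`. [folklore] -/
theorem exists_cobd_abs_linAvgIter_add_cobd_le_T3 (F : T3Family) (K : ℕ) {k : ℕ} (hk : k ≤ F.m + K)
    (a : PBond (F.P K) 0 → ℝ) :
    ∃ Φ : Site (F.P K) k → ℝ, ∀ c : PBond (F.P K) k,
      |linAvgIter k a c + cobd Φ c| ≤ 1 / Real.sqrt ((F.L : ℝ) ^ k) * Real.sqrt (∑ b : PBond (F.P K) 0, a b ^ 2) := by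
  have hk' : k ≤ (F.P K).m + (F.P K).K := hk
  obtain ⟨Φ, hΦ⟩ := linAvgIter_eq_tubeSum_sub_cobd hk' a
  exact ⟨Φ, fun c => abs_linAvgIter_add_cobd_le_T3 F K hk a Φ hΦ c⟩

end T3

end Summit.QuantumFields.YangMills.Theorems.PoincareLipschitzLinAvgModCobdLocal

end
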